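import Summits.CriticalPhenomena.PercolationContinuityZ3.Theorems.PercNearOneGluingNoHeavyLowerTailSahiLatinZeroBottomGrid
import Summits.CriticalPhenomena.PercolationContinuityZ3.Theorems.PercNearOneGluingNoHeavyLowerTailSahiLatinSlack

/-!
# `NoHeavyLowerTail` (crux stmt-CriticalPhenomena-4575), Sahi programme (prim-master-conj gen 49): POINT DENSITIES of the four grid parts and
# the POINTWISE RELAXATION of the grid invariant `Grid4` (the tool for the core/base case of the peeling theorem)

Support file (`--supports stmt-CriticalPhenomena-4575`; definitions (the four densities) + proofs, no `sorry`).  Memo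
`run/shared/lean/prim/prim-l12/FROM-prim-master-conj-g49-PEELING-THEOREM.md` §4.  Nothing here asserts the crux, Kahn's conjecture or (C¼).

THE MATHEMATICS.  Each grid part of `…SahiLatinZeroBottomPsi` is LINEAR in its set argument: `cXY(H; P,b,Q,c) = Σ_{u ∈ H} dXY(u)` with the
POINT DENSITIES (`N s u = |s ∩ link u|`, `Lam s t u = #{y ∈ link u : y ∈ s, anti u y ∈ t}` of `…SahiLatinKernel`, `n = |κ|`)
  `dSS(u) = 2^{n+1}([u∈Q][u∈b] + [u∈P][u∈c] + [u∈b][u∈c])`,      `dSO(u) = −[u∈P]·N_c(u) − [u∈b]·N_Q(u) + 3[u∈b]·N_c(u)`,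
  `dOS(u) = −[u∈Q]·N_b(u) − [u∈c]·N_P(u) + 3[u∈c]·N_b(u)`,          `dOO(u) = Λ_{P,c}(u) + Λ_{b,Q}(u) − 3Λ_{b,c}(u) − N_{Q∩b}(u) − N_{P∩c}(u) − N_{b∩c}(u)`
(`cSS_eq_sum` … `cOO_eq_sum`; first-point forms via `sum_lperm_eq_sum_link`).  Consequently (**pointwise relaxation**, `grid4_of_pointwise`): if a
function `m : [3]^κ → ℤ` with `0 ≤ Σ_u m(u)` bounds from below, at every point `u`, the contribution
`[u∈H_SS]dSS(u) + [u∈H_SO]dSO(u) + [u∈H_OS]dOS(u) + [u∈H_OO]dOO(u)` for EVERY membership pattern allowed at `u` (nested: `OO ⇒ SO, OS ⇒ SS`; forced: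
`u ∈ P∪Q ⇒ SS`, `u ∈ P ⇒ SO`, `u ∈ Q ⇒ OS`), then `Grid4 P b Q c` holds — dropping all coupling between different points.  On the CORE family
(`P′ = Q′ = Ω`, `P ⊥ Q` boxes) such an `m` exists (memo §4: the per-point minima, whose sum is `|P_U|S_V + |Q_V|S_U − |P_U||Q_V|C ≥ 0`); the concrete
instances are the companion file's business.  Axioms standard. [this work]
-/

namespace Summit.CriticalPhenomena.PercolationContinuityZ3.Theorems.SahiLatin

open Finset

variable {κ : Type*} [Fintype κ] [DecidableEq κ]

/-! ## §1  First-point forms -/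

/-- `latinTriples H s t = Σ_{u∈H} Λ_{s,t}(u)`. [this work] -/
theorem latinTriples_eq_sum_Lam (H s t : Finset (Pt κ)) : latinTriples H s t = ∑ u ∈ H, (Lam s t u : ℤ) := by
  unfold latinTriples
  rw [sum_lperm_eq_sum_link (fun x y z => ind H x * ind s y * ind t z)]
  rw [← sum_filter_add_sum_filter_not univ (fun u => u ∈ H)]
  have hz : ∑ u ∈ univ.filter (fun u => ¬ u ∈ H), ∑ y ∈ link u, ind H u * ind s y * ind t (anti u y) = 0 := by
    refine sum_eq_zero fun u hu => ?_
    rw [mem_filter] at hu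
    simp [ind_of_not_mem hu.2]
  rw [hz, add_zero, filter_mem_eq_inter, univ_inter]
  refine sum_congr rfl fun u hu => ?_
  rw [Lam, ← sum_boole]
  simp only [ind_of_mem hu, one_mul]
  refine sum_congr rfl fun y _ => ?_
  by_cases h1 : y ∈ s <;> by_cases h2 : anti u y ∈ t <;> simp [ind, h1, h2]

/-- `latinPairs (H ∩ X) Y = Σ_{u∈H} [u∈X]·N_Y(u)`. [this work] -/
theorem latinPairs_inter_eq_sum (H X Y : Finset (Pt κ)) : latinPairs (H ∩ X) Y = ∑ u ∈ H, ind X u * (N Y u : ℤ) := by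
  rw [← sum_N_eq_latinPairs, ← sum_filter_add_sum_filter_not H (fun u => u ∈ X)]
  have hz : ∑ u ∈ H.filter (fun u => ¬ u ∈ X), ind X u * (N Y u : ℤ) = 0 :=
    sum_eq_zero fun u hu => by rw [mem_filter] at hu; simp [ind_of_not_mem hu.2]
  rw [hz, add_zero, filter_mem_eq_inter]
  exact sum_congr rfl fun u hu => by rw [mem_inter] at hu; simp [ind_of_mem hu.2]

/-- `latinPairs H Y = Σ_{u∈H} N_Y(u)` (restated from `…Slack`). [this work] -/
theorem latinPairs_eq_sum_N (H Y : Finset (Pt κ)) : latinPairs H Y = ∑ u ∈ H, (N Y u : ℤ) := (sum_N_eq_latinPairs H Y).symm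

/-- `S1 (H ∩ X ∩ Y) = Σ_{u∈H} 2^n [u∈X][u∈Y]`. [this work] -/
theorem S1_inter_inter_eq_sum (H X Y : Finset (Pt κ)) : S1 (H ∩ X ∩ Y) = ∑ u ∈ H, 2 ^ Fintype.card κ * (ind X u * ind Y u) := by
  rw [S1_eq, inter_assoc, ← sum_ind_eq_card_inter, mul_sum]
  exact sum_congr rfl fun u _ => by rw [ind_inter]

/-! ## §2  The point densities -/

/-- Density of `cSS`: `2^{n+1}([u∈Q][u∈b] + [u∈P][u∈c] + [u∈b][u∈c])`. [this work] -/
def dSS (P b Q c : Finset (Pt κ)) (u : Pt κ) : ℤ := 2 ^ (Fintype.card κ + 1) * (ind Q u * ind b u + ind P u * ind c u + ind b u * ind c u)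

/-- Density of `cSO`: `−[u∈P]N_c(u) − [u∈b]N_Q(u) + 3[u∈b]N_c(u)`. [this work] -/
def dSO (P b Q c : Finset (Pt κ)) (u : Pt κ) : ℤ := -(ind P u * (N c u : ℤ)) - ind b u * (N Q u : ℤ) + 3 * (ind b u * (N c u : ℤ))

/-- Density of `cOS`: `−[u∈Q]N_b(u) − [u∈c]N_P(u) + 3[u∈c]N_b(u)`. [this work] -/
def dOS (P b Q c : Finset (Pt κ)) (u : Pt κ) : ℤ := -(ind Q u * (N b u : ℤ)) - ind c u * (N P u : ℤ) + 3 * (ind c u * (N b u : ℤ))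

/-- Density of `cOO`: `Λ_{P,c} + Λ_{b,Q} − 3Λ_{b,c} − N_{Q∩b} − N_{P∩c} − N_{b∩c}`. [this work] -/
def dOO (P b Q c : Finset (Pt κ)) (u : Pt κ) : ℤ :=
  (Lam P c u : ℤ) + (Lam b Q u : ℤ) - 3 * (Lam b c u : ℤ) - (N (Q ∩ b) u : ℤ) - (N (P ∩ c) u : ℤ) - (N (b ∩ c) u : ℤ)

/-- `cSS(H) = Σ_{u∈H} dSS(u)`. [this work] -/
theorem cSS_eq_sum (H P b Q c : Finset (Pt κ)) : cSS H P b Q c = ∑ u ∈ H, dSS P b Q c u := by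
  unfold cSS dSS
  rw [S1_inter_inter_eq_sum, S1_inter_inter_eq_sum, S1_inter_inter_eq_sum, mul_sum, mul_sum, mul_sum, ← sum_add_distrib, ← sum_add_distrib]
  exact sum_congr rfl fun u _ => by rw [pow_succ]; ring

/-- `cSO(H) = Σ_{u∈H} dSO(u)`. [this work] -/
theorem cSO_eq_sum (H P b Q c : Finset (Pt κ)) : cSO H P b Q c = ∑ u ∈ H, dSO P b Q c u := by
  unfold cSO dSO
  rw [latinPairs_inter_eq_sum, latinPairs_inter_eq_sum, latinPairs_inter_eq_sum, mul_sum, ← sum_neg_distrib, ← sum_sub_distrib, ← sum_add_distrib]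

/-- `cOS(H) = Σ_{u∈H} dOS(u)`. [this work] -/
theorem cOS_eq_sum (H P b Q c : Finset (Pt κ)) : cOS H P b Q c = ∑ u ∈ H, dOS P b Q c u := by
  unfold cOS dOS
  rw [latinPairs_inter_eq_sum, latinPairs_inter_eq_sum, latinPairs_inter_eq_sum, mul_sum, ← sum_neg_distrib, ← sum_sub_distrib, ← sum_add_distrib]

/-- `cOO(H) = Σ_{u∈H} dOO(u)`. [this work] -/
theorem cOO_eq_sum (H P b Q c : Finset (Pt κ)) : cOO H P b Q c = ∑ u ∈ H, dOO P b Q c u := by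
  unfold cOO dOO
  rw [latinTriples_eq_sum_Lam, latinTriples_eq_sum_Lam, latinTriples_eq_sum_Lam, latinPairs_eq_sum_N, latinPairs_eq_sum_N, latinPairs_eq_sum_N,
    mul_sum, ← sum_add_distrib, ← sum_sub_distrib, ← sum_sub_distrib, ← sum_sub_distrib, ← sum_sub_distrib]

/-! ## §3  The pointwise relaxation -/

/-- The admissible membership patterns at a point `u` and the pattern value. [this work] -/
def PatternOK (P Q : Finset (Pt κ)) (u : Pt κ) (sSS sSO sOS sOO : Bool) : Prop :=
  (sOO = true → sSO = true) ∧ (sOO = true → sOS = true) ∧ (sSO = true → sSS = true) ∧ (sOS = true → sSS = true) ∧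
  (u ∈ P ∪ Q → sSS = true) ∧ (u ∈ P → sSO = true) ∧ (u ∈ Q → sOS = true)

/-- **Pointwise relaxation**: a pointwise lower bound `m` (valid for every admissible membership pattern at every point) with nonnegative
total gives the grid invariant `Grid4 P b Q c`. [this work] -/
theorem grid4_of_pointwise {P b Q c : Finset (Pt κ)} (m : Pt κ → ℤ) (hm : 0 ≤ ∑ u, m u)
    (h : ∀ u (sSS sSO sOS sOO : Bool), PatternOK P Q u sSS sSO sOS sOO →
      m u ≤ (if sSS then dSS P b Q c u else 0) + (if sSO then dSO P b Q c u else 0) + (if sOS then dOS P b Q c u else 0)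
        + (if sOO then dOO P b Q c u else 0)) :
    Grid4 P b Q c := by
  intro HSS HSO HOS HOO _ _ _ _ n1 n2 n3 n4 f1 f2 f3
  have e : ∀ (H : Finset (Pt κ)) (f : Pt κ → ℤ), ∑ u ∈ H, f u = ∑ u, (if u ∈ H then f u else 0) := by
    intro H f; rw [← sum_filter, filter_mem_eq_inter, univ_inter]
  rw [cSS_eq_sum, cSO_eq_sum, cOS_eq_sum, cOO_eq_sum, e HSS, e HSO, e HOS, e HOO, ← sum_add_distrib, ← sum_add_distrib, ← sum_add_distrib]
  refine le_trans hm (sum_le_sum fun u _ => ?_)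
  have hu := h u (decide (u ∈ HSS)) (decide (u ∈ HSO)) (decide (u ∈ HOS)) (decide (u ∈ HOO))
    ⟨fun h' => decide_eq_true (n1 (of_decide_eq_true h')), fun h' => decide_eq_true (n2 (of_decide_eq_true h')),
     fun h' => decide_eq_true (n3 (of_decide_eq_true h')), fun h' => decide_eq_true (n4 (of_decide_eq_true h')),
     fun h' => decide_eq_true (f1 h'), fun h' => decide_eq_true (f2 h'), fun h' => decide_eq_true (f3 h')⟩
  simpa only [decide_eq_true_eq] using hu

end Summit.CriticalPhenomena.PercolationContinuityZ3.Theorems.SahiLatin
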